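import Summits.BirchSwinnertonDyer.BirchSwinnertonDyer.Theorems.KatoDescentPotSupersingularKatoSelmerSharpBound
import Summits.BirchSwinnertonDyer.BirchSwinnertonDyer.Theorems.KatoDescentPotSupersingularKummerKernelOrthogonal
import Summits.BirchSwinnertonDyer.BirchSwinnertonDyer.Theorems.KatoDescentPotSupersingularKummerTowerOrthogonal
import HarnessLib

/-!
# Brick (a) of crux M's level-0 ledger for KATO'S `A = H¹(ℤ[1/p], T_pE)`:
# `#S(E[p^∞]) · [B_k : B_k ∩ 𝓚_k^⊥] ≤ #Sel_str^{ur}(E[p^∞]) · p^k`, `B_k = loc_p (desc^♭)_* red_{p^k}(A)`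
# (route `KatoDescentPotSupersingular` / `…Tame…`, crux M = stmt-BirchSwinnertonDyer-19196; route-free helper)

Seat `bsd-potss-rkm` g19 (prover; cell `bsd-potss`), item stmt-BirchSwinnertonDyer-19196 (`--supports … --as helper`; closes
nothing).  HONEST FRAMING: BSD is not proved by any of this; nothing is booked; theorems only (no definition, no named fact).

## What (memo `HOME/rkm/FINDING-19196-rkm-g18.md` §ARCHITECTURE: brick (a) with its two hypotheses `hA'`, `hZ` DISCHARGED for Kato's `A`)

Part 36 (`…KatoSelmerSharpBound.natCard_kato_mul_relIndex_le_of_ker_le`) proves the sharp S-side inequality for ANY subgroup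
`A' ≤ H¹(ℚ, E[p^k])` of classes unramified off `p`, ANY equivariant `g : E[p^k] → E[p^k]^D`, granted `ker ι_k ≤ {}^⊥(loc_p g_* A')`.  Here:

* §1 (the `Kato2004` level dialect `(p : ℤ)^k` meets the `X11b`/`WeilPairingLevelDescent` dialect `((p^k : ℕ) : ℤ)` through the
  identity-on-points maps `torsionInclusion`) **`map_mulK_map_torsionInclusion_reduceH1Pk_add`**: for `c ∈ H¹(ℚ, T_pE)`,
  `[p^j]_* (ι″_* red_{p^{k+j}} c) = ι′_* red_{p^k} c` in `H¹(ℚ, E[p^k])` — the `j`-step tower of part 29 read through the transports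
  `ι′ : E[(p:ℤ)^k] ⥲ E[((p^k:ℕ):ℤ)]`, `ι″ : E[(p:ℤ)^{k+j}] ⥲ E[((p^j p^k:ℕ):ℤ)]` (cocycle-level: `p^j • a_{k+j} = a_k` on `T_pE`,
  `pow_zsmul_coe_tateModPk_add`); and its localisation `localization_map_torsionInclusion_reduceH1Pk_eq_map_mulK`.
* §2 **`natCard_kato_mul_relIndex_le`** — the INSTANTIATED brick (a): `A' = red'_{p^k}(A)`, `A = integralH1 (tateRep W p) p ⊤ = H¹(ℤ[1/p], T_pE)`,
  `g = (desc)^♭` the dual map of the DESCENDED Weil pairing `E[p^k] × E[p^k] → μ_{p^j p^k}` of a level-`p^j p^k` Weil datum `e`, Poitou–Tate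
  family `inv` at level `p^j p^k` (`p` odd), `p^j` killing the `p`-power torsion of `E(ℚ_p)`; `hA'` = part 31
  `localization_ofTopSubgroup_reduceH1Pk_mem_unramifiedSubgroup` transported along `ι′`; `hZ` = part 35 `ker_map_primaryInclusion_le_annLeft`
  with the tower witnesses of §1.  CONCLUSION: **`#S · [B_k : B_k ⊓ 𝓚_k^⊥] ≤ #Sel_str^{ur} · p^k`** with
  `B_k = loc_p (desc^♭)_* ι′_* red_{p^k}(H¹(ℤ[1/p],T_pE))` — the memo's `#S(W) ≤ #Sel_str^{ur}(W) · p^K/#im_K(A)`.  What brick (b) must now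
  supply is a LOWER bound for `[B_k : B_k ⊓ 𝓚_k^⊥] = #im_k(A)` from the zeta element (`HasLocPKummerLog` / Kato 14.18).

References: K. Kato, Astérisque 295 (2004), §13.8, §14.8, Prop. 14.16 and proof (pp. 244–245) [Kato2004Asterisque]; J. S. Milne, *ADT* I
Cor. 2.3, Thm. 2.6, Lemma 3.3, Thm. 4.10 (b), §6 [MilneADT2006]; B. Perrin-Riou, Bull. SMF 115 (1987) §0 [PerrinRiou1987BSMF].
-/

-- the summit and its single problem are both named `BirchSwinnertonDyer` (registry layout D-0017)
set_option linter.dupNamespace false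
set_option autoImplicit false

noncomputable section

open scoped Classical ContRepresentation NumberField
open CategoryTheory Function Field NumberField IsDedekindDomain WeierstrassCurve
open Literature.NumberTheory.EllipticCurves Literature.NumberTheory.GaloisRepresentations
  Literature.NumberTheory.GaloisRepresentations.DiscreteGaloisModule Literature.NumberTheory.GaloisCohomology
open Literature.NumberTheory.EllipticCurves.Kato2004 Literature.NumberTheory.EllipticCurves.Kato2004.EulerSystemValues
open Summit.BirchSwinnertonDyer.Rank1Residual.X11b.Levels Summit.BirchSwinnertonDyer.Rank1Residual.X11b.LocBridge
  Summit.BirchSwinnertonDyer.Rank1Residual.X11b.LevelKummer Summit.BirchSwinnertonDyer.Rank1Residual.X11b.FiniteDuality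
open Summit.BirchSwinnertonDyer.Rank1Residual.GaloisImage
open Summit.BirchSwinnertonDyer.BirchSwinnertonDyer.Rank1Residual (StepFour.localization_map_mem_unramifiedSubgroup)

universe u

/-! ## §1 The `j`-step tower through the level transports `torsionInclusion` -/

namespace Summit.BirchSwinnertonDyer.BirchSwinnertonDyer.Theorems.KummerTowerOrthogonal

section Levels

variable (p k j : ℕ)

/-- `(p : ℤ)^k ∣ ((p^k : ℕ) : ℤ)` — the `Kato2004` level `(p : ℤ)^k` divides (indeed equals, `Nat.cast_pow`) the `X11b` level
`((p^k : ℕ) : ℤ)`; the divisibility is what `WeierstrassCurve.torsionInclusion` consumes. [folklore] -/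
theorem intPow_dvd_natCast_pow : ((p : ℤ) ^ k) ∣ ((p ^ k : ℕ) : ℤ) :=
  ⟨1, by rw [Nat.cast_pow, mul_one]⟩

/-- `(p : ℤ)^{k+j} ∣ ((p^j · p^k : ℕ) : ℤ)` (the top level of the `j`-step tower in the two dialects). [folklore] -/
theorem intPow_add_dvd_natCast_mul_pow : ((p : ℤ) ^ (k + j)) ∣ ((p ^ j * p ^ k : ℕ) : ℤ) :=
  ⟨1, by rw [Nat.cast_mul, Nat.cast_pow, Nat.cast_pow, mul_one, pow_add, mul_comm]⟩

end Levels

section OfTop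

variable {K : Type u} [Field K] {M : Type u} [AddCommGroup M] [TopologicalSpace M] [DiscreteTopology M]

/-- `ofTopSubgroup : H¹(⊤, M) → H¹(Γ_K, M)` on classes of continuous crossed homomorphisms of a discrete Galois module (pull-back along
`Γ_K ≅ ⊤`; the tree's `map_oneCocycleClass`). [folklore] -/
theorem ofTopSubgroup_hom_oneCocycleClass (ρ : DiscreteGaloisModule K M) (ψ : contOneCocycles (subgroupRep ρ.toTopRep ⊤)) :
    (ofTopSubgroup ρ.toTopRep 1).hom (oneCocycleClass _ ψ) =
      oneCocycleClass ρ.toTopRep (contOneCocycles.pullback toTopSubgroupHom (X := subgroupRep ρ.toTopRep ⊤) (Y := ρ.toTopRep)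
        (TopRep.ofHom ⟨ContinuousLinearMap.id ℤ M, fun _ => rfl⟩) ψ) :=
  map_oneCocycleClass _ _ _ ψ

end OfTop

section Tower

variable (W : WeierstrassCurve ℚ) [W.IsElliptic] (p k j : ℕ) [Fact p.Prime] [ContinuousSMul ℤ_[p] (W.tateModule p)]

/-- **The `j`-step tower through the level transports: `[p^j]_* (ι″_* red_{p^{k+j}} c) = ι′_* red_{p^k} c` in `H¹(ℚ, E[((p^k:ℕ):ℤ)])`**
for every `c ∈ H¹(ℚ, T_pE)`, where `ι′ : E[(p:ℤ)^k] → E[((p^k:ℕ):ℤ)]`, `ι″ : E[(p:ℤ)^{k+j}] → E[((p^j p^k:ℕ):ℤ)]` are the identity-on-points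
transports (`torsionInclusion`) and `[p^j] = mulK W (p^j) (p^k)`: on cocycles both sides are `g ↦ p^j • a_{k+j}(g) = a_k(g)`
(`pow_zsmul_coe_tateModPk_add`). [cite: Kato2004Asterisque, §13.8 (p. 228)] [cite: PerrinRiou1987BSMF, §0 (p. 401)] -/
theorem map_mulK_map_torsionInclusion_reduceH1Pk_add (c : H1 (tateRep W p) ⊤) :
    galoisCohomology.map (mulK W (p ^ j) (p ^ k)) 1
        (galoisCohomology.map (W.torsionInclusion (intPow_add_dvd_natCast_mul_pow p k j)) 1
          ((ofTopSubgroup (W.torsionGaloisModule ((p : ℤ) ^ (k + j))).toTopRep 1).hom (reduceH1Pk W p (k + j) ⊤ c))) =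
      galoisCohomology.map (W.torsionInclusion (intPow_dvd_natCast_pow p k)) 1
        ((ofTopSubgroup (W.torsionGaloisModule ((p : ℤ) ^ k)).toTopRep 1).hom (reduceH1Pk W p k ⊤ c)) := by
  obtain ⟨φ, rfl⟩ := oneCocycleClass_surjective _ c
  rw [reduceH1Pk_oneCocycleClass, reduceH1Pk_oneCocycleClass, ofTopSubgroup_hom_oneCocycleClass,
    ofTopSubgroup_hom_oneCocycleClass, galoisCohomology.map_one_oneCocycleClass, galoisCohomology.map_one_oneCocycleClass,
    galoisCohomology.map_one_oneCocycleClass]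
  refine congrArg _ (Subtype.ext (ContinuousMap.ext fun g ↦ Subtype.ext ?_))
  change ((p ^ j : ℕ) : ℤ) • ((tateModPk W p (k + j) (φ.1 (toTopSubgroupHom g)) : geomTorsion W ((p : ℤ) ^ (k + j))) :
      geomPoints W) =
    ((tateModPk W p k (φ.1 (toTopSubgroupHom g)) : geomTorsion W ((p : ℤ) ^ k)) : geomPoints W)
  rw [Nat.cast_pow, pow_zsmul_coe_tateModPk_add]

/-- **Localised: `loc_p (ι′_* red_{p^k} c) = [p^j]^loc_* loc_p (ι″_* red_{p^{k+j}} c)`** — every element of `B_k` comes down the tower, the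
form of the hypothesis `hY` of part 35 `ker_map_primaryInclusion_le_annLeft`. [cite: Kato2004Asterisque, §13.8 (p. 228)] -/
theorem localization_map_torsionInclusion_reduceH1Pk_eq_map_mulK (v : Place ℚ) (c : H1 (tateRep W p) ⊤) :
    galoisCohomology.localization (W.torsionGaloisModule ((p ^ k : ℕ) : ℤ)) v 1
        (galoisCohomology.map (W.torsionInclusion (intPow_dvd_natCast_pow p k)) 1
          ((ofTopSubgroup (W.torsionGaloisModule ((p : ℤ) ^ k)).toTopRep 1).hom (reduceH1Pk W p k ⊤ c))) =
      galoisCohomology.map ((mulK W (p ^ j) (p ^ k)).restrictField (Place.Completion v)) 1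
        (galoisCohomology.localization (W.torsionGaloisModule ((p ^ j * p ^ k : ℕ) : ℤ)) v 1
          (galoisCohomology.map (W.torsionInclusion (intPow_add_dvd_natCast_mul_pow p k j)) 1
            ((ofTopSubgroup (W.torsionGaloisModule ((p : ℤ) ^ (k + j))).toTopRep 1).hom (reduceH1Pk W p (k + j) ⊤ c)))) := by
  rw [← map_mulK_map_torsionInclusion_reduceH1Pk_add W p k j c, localization_map_one']

end Tower

end Summit.BirchSwinnertonDyer.BirchSwinnertonDyer.Theorems.KummerTowerOrthogonal

/-! ## §2 Brick (a) for Kato's `A = H¹(ℤ[1/p], T_pE)` and the descended Weil transport -/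

namespace Summit.BirchSwinnertonDyer.BirchSwinnertonDyer.Theorems.KatoFiniteLevelCount

open Summit.BirchSwinnertonDyer.BirchSwinnertonDyer.Theorems.KummerTowerOrthogonal

section Kato

variable (W : WeierstrassCurve ℚ) [W.IsElliptic] (p : ℕ) [Fact p.Prime] (m e j : ℕ) [ContinuousSMul ℤ_[p] (W.tateModule p)]
  (𝓤inf 𝓢inf : SelmerStructure (primaryGaloisModule W p))
  [Finite (geomTorsion W ((p ^ (m + e) : ℕ) : ℤ))]
  (inv : LocalInvariants ℚ (p ^ j * p ^ (m + e)))
  (ε : geomTorsion W ((p ^ j * p ^ (m + e) : ℕ) : ℤ) → geomTorsion W ((p ^ j * p ^ (m + e) : ℕ) : ℤ) → AlgebraicClosure ℚ)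
  (hμ : ∀ S T, ε S T ^ (p ^ j * p ^ (m + e)) = 1)
  (hadd₁ : ∀ S₁ S₂ T, ε (S₁ + S₂) T = ε S₁ T * ε S₂ T)
  (hadd₂ : ∀ S T₁ T₂, ε S (T₁ + T₂) = ε S T₁ * ε S T₂)
  (hgal : ∀ (σ : absoluteGaloisGroup ℚ) (S T : geomTorsion W ((p ^ j * p ^ (m + e) : ℕ) : ℤ)), σ • ε S T = ε (σ • S) (σ • T))

/-- **Brick (a) of crux M's level-0 ledger, for Kato's `A = H¹(ℤ[1/p], T_pE)`: `#S · [B_k : B_k ⊓ 𝓚_k^⊥] ≤ #Sel_str^{ur} · p^k`**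
(`k = m + e`).  Data/hypotheses: `p` odd; `𝓤∞`/`𝓢∞` Kato's relaxed/strict structures on `E[p^∞]` (`⊤`/`0` at `v_p`, unramified at `ℓ ≠ p`,
`⊤` at `∞`), `S = H¹_{𝓤∞} ⊓ selmerLocalKerPrimary` Kato's group (Kummer at `p`, unramified off `p`), `p^m · S = 0`, (hN) off `p` at `(m, e)`
(g17 `exists_forall_hN`), `p^j` killing the `p`-power torsion of `E(ℚ_p)`, a level-`p^j p^k` Weil datum `ε`, a Poitou–Tate family `inv` at
level `p^j p^k` perfect at `v_p`.  `B_k = loc_p (desc^♭)_* ι′_* red_{p^k}(A) ≤ H¹(ℚ_p, E[p^k]^D)` (`desc` the descended Weil pairing,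
`ι′` the level transport, `red_{p^k}` Kato's reduction), `𝓚_k` the local Kummer condition, `b = ⟨·,·⟩_p`.  Proof: part 36 with `hA'` from
part 31 (integral classes reduce to classes unramified off `p`) and `hZ` from part 35 (torsion Kummer classes are orthogonal to tower
classes) via §1.  This is `#S(E[p^∞]) ≤ #Sel_str^{ur}(E[p^∞]) · p^k / #im_k(A)` of the memo, `im_k(A) = B_k/(B_k ⊓ 𝓚_k^⊥)`, with NO loss
of the local torsion `p^{t_p}`. [cite: Kato2004Asterisque, Prop. 14.16 and its proof (pp. 244–245)]
[cite: MilneADT2006, Ch. I, Cor. 2.3, Thm. 2.6, Lemma 3.3, Thm. 4.10 (b)] -/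
theorem natCard_kato_mul_relIndex_le (hodd : p ≠ 2)
    (hsum : inv.SumLocalTermEqZero) (hperf : inv.IsPerfect)
    (hUp : 𝓤inf (Sum.inr (primePlace p)) = ⊤)
    (hUur : ∀ v : HeightOneSpectrum (𝓞 ℚ), v ≠ primePlace p →
      𝓤inf (Sum.inr v) = unramifiedSubgroup (GaloisRep.toLocal v (primaryGaloisModule W p)) 1)
    (hUinl : ∀ w : InfinitePlace ℚ, 𝓤inf (Sum.inl w) = ⊤)
    (hSp : 𝓢inf (Sum.inr (primePlace p)) = ⊥)
    (hSur : ∀ v : HeightOneSpectrum (𝓞 ℚ), v ≠ primePlace p →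
      𝓢inf (Sum.inr v) = unramifiedSubgroup (GaloisRep.toLocal v (primaryGaloisModule W p)) 1)
    (hSinl : ∀ w : InfinitePlace ℚ, 𝓢inf (Sum.inl w) = ⊤)
    (hm : ∀ c ∈ 𝓤inf.selmerGroup ⊓ selmerLocalKerPrimary W ((primePlace p).adicCompletion ℚ) p, p ^ m • c = 0)
    (hNur : ∀ v : HeightOneSpectrum (𝓞 ℚ), v ≠ primePlace p → ∀ x : W.geomPrimaryTorsion p,
      (∀ τ ∈ absInertia (v.adicCompletion ℚ), GaloisRep.toLocal v (primaryGaloisModule W p) τ x = x) →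
        ∃ d : W.geomPrimaryTorsion p,
          (∀ τ ∈ absInertia (v.adicCompletion ℚ), GaloisRep.toLocal v (primaryGaloisModule W p) τ d = d) ∧
            p ^ (m + e) • d = p ^ e • x)
    (hj : ∀ τ : (W.baseChange ((primePlace p).adicCompletion ℚ)).toAffine.Point, (∃ a : ℕ, p ^ a • τ = 0) → p ^ j • τ = 0) :
    haveI := neZero_pow p j; haveI := neZero_pow p (m + e)
    Nat.card ↥(𝓤inf.selmerGroup ⊓ selmerLocalKerPrimary W ((primePlace p).adicCompletion ℚ) p) *
        ((((integralH1 (tateRep W p) p ⊤).toAddSubgroup.map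
              (((galoisCohomology.map (W.torsionInclusion (intPow_dvd_natCast_pow p (m + e))) 1).comp
                  (ofTopSubgroup (W.torsionGaloisModule ((p : ℤ) ^ (m + e))).toTopRep 1).hom.toLinearMap.toAddMonoidHom).comp
                (reduceH1Pk W p (m + e) ⊤))).map
              (galoisCohomology.map (DiscreteGaloisModule.pairingDualIntertwining
                (ρ₁ := W.torsionGaloisModule ((p ^ (m + e) : ℕ) : ℤ)) (ρ₂ := W.torsionGaloisModule ((p ^ (m + e) : ℕ) : ℤ))
                (B := descendHom W (p ^ j) (p ^ (m + e)) ε hμ hadd₁ hadd₂)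
                (descendHom_smul W (p ^ j) (p ^ (m + e)) ε hμ hadd₁ hadd₂ hgal)) 1)).map
            (galoisCohomology.localization ((W.torsionGaloisModule ((p ^ (m + e) : ℕ) : ℤ)).tateDual (p ^ j * p ^ (m + e)))
              (Sum.inr (primePlace p)) 1) ⊓
          annRight (localTatePairingZMod (W.torsionGaloisModule ((p ^ (m + e) : ℕ) : ℤ)) (p ^ j * p ^ (m + e))
            (Sum.inr (primePlace p)) (inv (Sum.inr (primePlace p))))
            (W.kummerSelmerStructure ((p ^ (m + e) : ℕ) : ℤ) (Sum.inr (primePlace p)))).relIndex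
          ((((integralH1 (tateRep W p) p ⊤).toAddSubgroup.map
              (((galoisCohomology.map (W.torsionInclusion (intPow_dvd_natCast_pow p (m + e))) 1).comp
                  (ofTopSubgroup (W.torsionGaloisModule ((p : ℤ) ^ (m + e))).toTopRep 1).hom.toLinearMap.toAddMonoidHom).comp
                (reduceH1Pk W p (m + e) ⊤))).map
              (galoisCohomology.map (DiscreteGaloisModule.pairingDualIntertwining
                (ρ₁ := W.torsionGaloisModule ((p ^ (m + e) : ℕ) : ℤ)) (ρ₂ := W.torsionGaloisModule ((p ^ (m + e) : ℕ) : ℤ))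
                (B := descendHom W (p ^ j) (p ^ (m + e)) ε hμ hadd₁ hadd₂)
                (descendHom_smul W (p ^ j) (p ^ (m + e)) ε hμ hadd₁ hadd₂ hgal)) 1)).map
            (galoisCohomology.localization ((W.torsionGaloisModule ((p ^ (m + e) : ℕ) : ℤ)).tateDual (p ^ j * p ^ (m + e)))
              (Sum.inr (primePlace p)) 1)) ≤
      Nat.card 𝓢inf.selmerGroup * p ^ (m + e) := by
  haveI := neZero_pow p j; haveI := neZero_pow p (m + e)
  have hp : p.Prime := Fact.out
  -- the auxiliary level `N = p^j · p^k` is odd and divisible by `p^k`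
  have hN : Odd (p ^ j * p ^ (m + e)) := (hp.odd_of_ne_two hodd).pow.mul (hp.odd_of_ne_two hodd).pow
  have hkN : p ^ (m + e) ∣ p ^ j * p ^ (m + e) := Dvd.intro_left _ rfl
  refine natCard_kato_mul_relIndex_le_of_ker_le W p m e 𝓤inf 𝓢inf inv _ _ hN hkN hsum hperf hUp hUur hUinl hSp hSur hSinl hm hNur
    ?_ ?_
  · -- `hA'`: reductions of integral classes are unramified off `p` (part 31), transported along `ι′`
    rintro _ ⟨a, ha, rfl⟩ v hv
    have h := StepFour.localization_map_mem_unramifiedSubgroup (W.torsionInclusion (intPow_dvd_natCast_pow p (m + e))) v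
      (localization_ofTopSubgroup_reduceH1Pk_mem_unramifiedSubgroup W p (m + e) ha hv)
    rw [AddMonoidHom.comp_apply, AddMonoidHom.comp_apply]
    exact h
  · -- `hZ`: torsion Kummer classes ⊥ tower classes (part 35), the tower witnesses from §1
    refine ker_map_primaryInclusion_le_annLeft W p (m + e) j (primePlace p) ε hμ hadd₁ hadd₂ hgal hj (inv (Sum.inr (primePlace p))) _ ?_
    rintro _ ⟨_, ⟨_, ⟨a, ha, rfl⟩, rfl⟩, rfl⟩
    refine ⟨galoisCohomology.localization (W.torsionGaloisModule ((p ^ j * p ^ (m + e) : ℕ) : ℤ)) (Sum.inr (primePlace p)) 1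
      (galoisCohomology.map (W.torsionInclusion (intPow_add_dvd_natCast_mul_pow p (m + e) j)) 1
        ((ofTopSubgroup (W.torsionGaloisModule ((p : ℤ) ^ (m + e + j))).toTopRep 1).hom (reduceH1Pk W p (m + e + j) ⊤ a))), ?_⟩
    rw [AddMonoidHom.comp_apply, AddMonoidHom.comp_apply, localization_map_one',
      ← localization_map_torsionInclusion_reduceH1Pk_eq_map_mulK W p (m + e) j (Sum.inr (primePlace p)) a]
    rfl

end Kato

end Summit.BirchSwinnertonDyer.BirchSwinnertonDyer.Theorems.KatoFiniteLevelCount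

end
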